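import Summits.HodgeConjecture.HodgeConjecture.Theorems.Ring2WeilCoverageResidueDictionaryPieces
import HarnessLib

/-!
# Weil-type family coverage — the residue dictionary for `√−11` and for the REAL PIECES `√2, √3, √5, √13`:
# `Re φ(δ) < 0` iff the unit residue `t` moves the index set onto the complementary coset

research route conditional on HC_CM; not a corollary; Q11.4-sentence-2 already refuted in dim ≥ 3.

Ring 2, WEIL-TYPE FAMILY-COVERAGE CENSUS (`HOME/WEIL-FAMILY-COVERAGE.md` `## b01`, blocks b01.23 (C)/(D), b01.34 (E),
b01.36; owner ring2-b01), part 26b of the `Ring2WeilCoverage*` series (continuation of part 26,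
`…ResidueDictionaryPieces`).  The engine of part 25 with:

| piece | `f` | `δ` | `S` | `S′` | (H3) |
|---|---|---|---|---|---|
| `√−11` | 11 | `1 + 2Σ_{a∈{1,3,4,5,9}} η^a` | `{1,3,4,5,9}` | `{2,6,7,8,10}` | `sin(5π/11) > sin(4π/11)`, rest `> 0` |
| `√2` | 8 | `ζ^{n/8} + ζ^{7n/8}` | `{1,7}` | `{3,5}` | `cos(π/4) > 0` |
| `√3` | 12 | `ζ^{n/12} + ζ^{11n/12}` | `{1,11}` | `{5,7}` | `cos(π/6) > 0` |
| `√5` | 5 | `1 + 2(η + η⁴)` | `{1,4}` | `{2,3}` | `cos(2π/5) > 0` |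
| `√13` | 13 | `1 + 2Σ_{a ∈ QR₁₃} η^a` | `{1,3,4,9,10,12}` | `{2,5,6,7,8,11}` | `cos(2π/13) > cos(5π/13)`, `cos(6π/13) > 0` |

For the real pieces the conclusion is about REAL parts: **`Re φ(δ) < 0 ↔ S.image (· * (t mod f)) = S′`**,
`Re φ(δ) ≠ 0`, `Im φ(δ) = 0` (`re_embedding_…_neg_iff`): `σ_t(√d) = χ_d(t)·√d`.  The composite census fields
`√−5 = i·√5`, `√−6 = √−2·√3`, `√−10 = √−2·√5`, `√−15 = √−3·√5`, `√−21 = √−7·√3`, `√−13 = i·√13` are then handled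
by part 25's `im_mul_neg_iff_xor` in part 27.

HONEST FRAMING: elementary trigonometry and finite sums; nothing here mentions Hodge classes, polarisations, `W_K`
or HC; `HC_CM` is used nowhere.  No `def`, no named fact, no `sorry`.

References: [cite: Washington1997, Lemma 4.7–4.8 and §8.1]; [cite: Aoki2002CMFermatType, §1 (p. 102)]; census b01.34
(E) (seat-derived).
-/

noncomputable section

open Complex Finset
open scoped Real

namespace Summit.HodgeConjecture.Ring2WeilCoverage.ResidueDictionaryPiecesB

open Summit.HodgeConjecture.Ring2WeilCoverage.ResidueDictionary
open Summit.HodgeConjecture.Ring2WeilCoverage.ResidueDictionaryPieces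

/-- `𝐞(x) = exp(2πi x/f) ∈ ℂ` (`ZMod.toCircle` at the level of `x`). -/
local notation3 (prettyPrint := false) "𝐞 " t:max => ((ZMod.toCircle t : Circle) : ℂ)

variable {K : Type} [Field K] {n : ℕ} [NeZero n] {ζ : K}

/-! ### §1 `K = ℚ(√−11)`: `δ = 1 + 2Σ_{a∈{1,3,4,5,9}} η^a`, `η = ζ^{n/11}`, `f = 11` -/

/-- (H1)–(H3) at `f = 11`: units carry the quadratic residues `{1,3,4,5,9}` to themselves or to `{2,6,7,8,10}`;
`2Σ_{k=1}^{10} 𝐞₁₁(k) + 2 = 0`; `Im(1 + 2Σ_{QR} 𝐞₁₁(a)) > 0` (`sin(5π/11) > sin(4π/11)`, the rest positive).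
research route conditional on HC_CM; not a corollary; Q11.4-sentence-2 already refuted in dim ≥ 3. [folklore] -/
theorem hyps_eleven :
    (∀ s : ZMod 11, IsUnit s → ({1, 3, 4, 5, 9} : Finset (ZMod 11)).image (· * s) = {1, 3, 4, 5, 9} ∨
        ({1, 3, 4, 5, 9} : Finset (ZMod 11)).image (· * s) = {2, 6, 7, 8, 10}) ∧
      (((2 : ℕ) : ℂ) * (∑ a ∈ ({1, 3, 4, 5, 9} : Finset (ZMod 11)), 𝐞 a +
          ∑ a ∈ ({2, 6, 7, 8, 10} : Finset (ZMod 11)), 𝐞 a) + 2 * ((1 : ℕ) : ℂ) = 0) ∧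
      0 < ((((1 : ℕ) : ℂ)) + ((2 : ℕ) : ℂ) * ∑ a ∈ ({1, 3, 4, 5, 9} : Finset (ZMod 11)), 𝐞 a).im := by
  refine ⟨fun s hs => ?_, ?_, ?_⟩
  · obtain ⟨u, rfl⟩ := hs
    have := ZMod.val_coe_unit_coprime u
    revert this; generalize (u : ZMod 11) = s; revert s; decide
  · rw [Finset.sum_insert (by decide), Finset.sum_insert (by decide), Finset.sum_insert (by decide),
      Finset.sum_pair (by decide), Finset.sum_insert (by decide), Finset.sum_insert (by decide),
      Finset.sum_insert (by decide), Finset.sum_pair (by decide),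
      show (2 : ZMod 11) = ((2 : ℕ) : ZMod 11) by norm_num, show (3 : ZMod 11) = ((3 : ℕ) : ZMod 11) by norm_num,
      show (4 : ZMod 11) = ((4 : ℕ) : ZMod 11) by norm_num, show (5 : ZMod 11) = ((5 : ℕ) : ZMod 11) by norm_num,
      show (6 : ZMod 11) = ((6 : ℕ) : ZMod 11) by norm_num, show (7 : ZMod 11) = ((7 : ℕ) : ZMod 11) by norm_num,
      show (8 : ZMod 11) = ((8 : ℕ) : ZMod 11) by norm_num, show (9 : ZMod 11) = ((9 : ℕ) : ZMod 11) by norm_num,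
      show (10 : ZMod 11) = ((10 : ℕ) : ZMod 11) by norm_num]
    simp only [toCircle_natCast_eq_pow]
    have hg := geom_sum_toCircle_one (f := 11) (by norm_num)
    simp only [Finset.sum_range_succ, Finset.sum_range_zero, zero_add, pow_zero, pow_one] at hg
    push_cast
    linear_combination 2 * hg
  · rw [Finset.sum_insert (by decide), Finset.sum_insert (by decide), Finset.sum_insert (by decide),
      Finset.sum_pair (by decide),
      show (3 : ZMod 11) = ((3 : ℕ) : ZMod 11) by norm_num, show (4 : ZMod 11) = ((4 : ℕ) : ZMod 11) by norm_num,
      show (5 : ZMod 11) = ((5 : ℕ) : ZMod 11) by norm_num, show (9 : ZMod 11) = ((9 : ℕ) : ZMod 11) by norm_num]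
    simp only [toCircle_natCast_eq_pow]
    simp only [Complex.add_im, Complex.mul_im, Complex.natCast_re, Complex.natCast_im, zero_mul, add_zero,
      im_re_toCircle_one, im_re_toCircle_one_pow]
    have hπ := Real.pi_pos
    have e9 : Real.sin (2 * π * (9 : ℕ) / (11 : ℕ)) = -Real.sin (4 * π / 11) := by
      rw [show (2 * π * (9 : ℕ) / (11 : ℕ) : ℝ) = 2 * π - 4 * π / 11 by push_cast; ring, Real.sin_two_pi_sub]
    have e3 : Real.sin (2 * π * (3 : ℕ) / (11 : ℕ)) = Real.sin (5 * π / 11) := by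
      rw [show (2 * π * (3 : ℕ) / (11 : ℕ) : ℝ) = π - 5 * π / 11 by push_cast; ring, Real.sin_pi_sub]
    have h45 : Real.sin (4 * π / 11) < Real.sin (5 * π / 11) := by
      apply Real.sin_lt_sin_of_lt_of_le_pi_div_two <;> nlinarith
    have h1 : 0 < Real.sin (2 * π * (1 : ℕ) / (11 : ℕ)) :=
      Real.sin_pos_of_pos_of_lt_pi (by positivity) (by push_cast; nlinarith)
    have h4 : 0 < Real.sin (2 * π * (4 : ℕ) / (11 : ℕ)) :=
      Real.sin_pos_of_pos_of_lt_pi (by positivity) (by push_cast; nlinarith)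
    have h5 : 0 < Real.sin (2 * π * (5 : ℕ) / (11 : ℕ)) :=
      Real.sin_pos_of_pos_of_lt_pi (by positivity) (by push_cast; nlinarith)
    push_cast at e9 e3 h1 h4 h5 ⊢
    nlinarith

/-- **`K = ℚ(√−11)`, any level `n` with `11 ∣ n`: `Im φ(1 + 2(η + η³ + η⁴ + η⁵ + η⁹)) < 0 ↔ t mod 11 ∈
{2,6,7,8,10}`** (`η = ζ^{n/11}`; as `{1,3,4,5,9}·t = {2,6,7,8,10}`), non-zero, `Re = 0`, for `φ ζ = 𝐞_n(t)`, `t` a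
unit residue (`χ_{−11}(t) = −1 ⟺ t mod 11` is a non-residue).
research route conditional on HC_CM; not a corollary; Q11.4-sentence-2 already refuted in dim ≥ 3. [cite: Washington1997, Lemma 4.8] -/
theorem im_embedding_sqrtNegEleven_neg_iff (h11 : 11 ∣ n) {φ : K →+* ℂ} {t : ZMod n} (hφ : φ ζ = 𝐞 t)
    (ht : t.val.Coprime n) :
    (((φ (1 + 2 * (ζ ^ (n / 11) + ζ ^ (n / 11 * 3) + ζ ^ (n / 11 * 4) + ζ ^ (n / 11 * 5) +
          ζ ^ (n / 11 * 9)))).im < 0 ↔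
        ({1, 3, 4, 5, 9} : Finset (ZMod 11)).image (· * ((t.val : ℕ) : ZMod 11)) = {2, 6, 7, 8, 10}) ∧
      (φ (1 + 2 * (ζ ^ (n / 11) + ζ ^ (n / 11 * 3) + ζ ^ (n / 11 * 4) + ζ ^ (n / 11 * 5) +
          ζ ^ (n / 11 * 9)))).im ≠ 0) ∧
      (φ (1 + 2 * (ζ ^ (n / 11) + ζ ^ (n / 11 * 3) + ζ ^ (n / 11 * 4) + ζ ^ (n / 11 * 5) +
          ζ ^ (n / 11 * 9)))).re = 0 := by
  obtain ⟨H1, H2, H3⟩ := hyps_eleven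
  have hu := isUnit_cast_of_coprime h11 ht
  have hre0 := re_charSum_one_eq_zero ({1, 3, 4, 5, 9} : Finset (ZMod 11)) {2, 6, 7, 8, 10} 1 2 H2 (by decide)
  have hv1 : (1 : ZMod 11).val = 1 := rfl
  have hv3 : (3 : ZMod 11).val = 3 := rfl
  have hv4 : (4 : ZMod 11).val = 4 := rfl
  have hv5 : (5 : ZMod 11).val = 5 := rfl
  have hv9 : (9 : ZMod 11).val = 9 := rfl
  have helt : (1 + 2 * (ζ ^ (n / 11) + ζ ^ (n / 11 * 3) + ζ ^ (n / 11 * 4) + ζ ^ (n / 11 * 5) +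
      ζ ^ (n / 11 * 9)) : K) =
      ((1 : ℕ) : K) + (2 : ℕ) * ∑ a ∈ ({1, 3, 4, 5, 9} : Finset (ZMod 11)), ζ ^ (n / 11 * a.val) := by
    rw [Finset.sum_insert (by decide), Finset.sum_insert (by decide), Finset.sum_insert (by decide),
      Finset.sum_pair (by decide), hv1, hv3, hv4, hv5, hv9]
    push_cast; ring
  rw [helt, embedding_charSum_eq h11 hφ]
  exact ⟨im_charSum_neg_iff _ _ 1 2 H1 H2 H3 hu, re_charSum_eq_zero _ _ 1 2 H1 H2 hre0 hu⟩

/-! ### §2 `√2`: `δ = ζ^{n/8} + ζ^{7n/8}`, `f = 8`, `S = {1,7}`, `S′ = {3,5}` -/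

/-- (H1)–(H3) at `f = 8` for `S = {1,7}`: units carry `S` to `S` or `{3,5}`; `Σ_{odd} 𝐞₈ = 0`;
`Re(𝐞₈(1) + 𝐞₈(7)) = 2cos(π/4) > 0`.
research route conditional on HC_CM; not a corollary; Q11.4-sentence-2 already refuted in dim ≥ 3. [folklore] -/
theorem hyps_eight_real :
    (∀ s : ZMod 8, IsUnit s → ({1, 7} : Finset (ZMod 8)).image (· * s) = {1, 7} ∨
        ({1, 7} : Finset (ZMod 8)).image (· * s) = {3, 5}) ∧
      (((1 : ℕ) : ℂ) * (∑ a ∈ ({1, 7} : Finset (ZMod 8)), 𝐞 a + ∑ a ∈ ({3, 5} : Finset (ZMod 8)), 𝐞 a) +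
          2 * ((0 : ℕ) : ℂ) = 0) ∧
      0 < ((((0 : ℕ) : ℂ)) + ((1 : ℕ) : ℂ) * ∑ a ∈ ({1, 7} : Finset (ZMod 8)), 𝐞 a).re := by
  refine ⟨fun s hs => ?_, ?_, ?_⟩
  · obtain ⟨u, rfl⟩ := hs
    have := ZMod.val_coe_unit_coprime u
    revert this; generalize (u : ZMod 8) = s; revert s; decide
  · rw [Finset.sum_pair (by decide), Finset.sum_pair (by decide),
      show (3 : ZMod 8) = ((3 : ℕ) : ZMod 8) by norm_num, show (5 : ZMod 8) = ((5 : ℕ) : ZMod 8) by norm_num,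
      show (7 : ZMod 8) = ((7 : ℕ) : ZMod 8) by norm_num]
    simp only [toCircle_natCast_eq_pow, Nat.cast_one, one_mul, Nat.cast_zero, mul_zero, add_zero]
    have h4 : (𝐞 (1 : ZMod 8)) ^ 4 = -1 := by
      have := toCircle_one_pow_half (f := 8) (by decide)
      norm_num at this
      exact this
    linear_combination (𝐞 (1 : ZMod 8) + (𝐞 (1 : ZMod 8)) ^ 3) * h4
  · rw [Finset.sum_pair (by decide), show (7 : ZMod 8) = ((7 : ℕ) : ZMod 8) by norm_num]
    simp only [toCircle_natCast_eq_pow, Nat.cast_one, one_mul, Nat.cast_zero, zero_add, Complex.add_re,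
      im_re_toCircle_one, im_re_toCircle_one_pow]
    have hπ := Real.pi_pos
    have e7 : Real.cos (2 * π * (7 : ℕ) / (8 : ℕ)) = Real.cos (2 * π * (1 : ℕ) / (8 : ℕ)) := by
      rw [show (2 * π * (7 : ℕ) / (8 : ℕ) : ℝ) = 2 * π - 2 * π * (1 : ℕ) / (8 : ℕ) by push_cast; ring,
        Real.cos_two_pi_sub]
    have h1 : 0 < Real.cos (2 * π * (1 : ℕ) / (8 : ℕ)) :=
      Real.cos_pos_of_mem_Ioo ⟨by push_cast; nlinarith, by push_cast; nlinarith⟩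
    rw [e7]; linarith

/-- **`√2`, any level `n` with `8 ∣ n`: `Re φ(ζ^{n/8} + ζ^{7n/8}) < 0 ↔ t mod 8 ∈ {3, 5}`** (as `{1,7}·t = {3,5}`),
non-zero, `Im = 0` (`σ_t(√2) = χ_8(t)√2`).
research route conditional on HC_CM; not a corollary; Q11.4-sentence-2 already refuted in dim ≥ 3. [folklore] -/
theorem re_embedding_sqrtTwo_neg_iff (h8 : 8 ∣ n) {φ : K →+* ℂ} {t : ZMod n} (hφ : φ ζ = 𝐞 t)
    (ht : t.val.Coprime n) :
    (((φ (ζ ^ (n / 8) + ζ ^ (n / 8 * 7))).re < 0 ↔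
        ({1, 7} : Finset (ZMod 8)).image (· * ((t.val : ℕ) : ZMod 8)) = {3, 5}) ∧
      (φ (ζ ^ (n / 8) + ζ ^ (n / 8 * 7))).re ≠ 0) ∧ (φ (ζ ^ (n / 8) + ζ ^ (n / 8 * 7))).im = 0 := by
  obtain ⟨H1, H2, H3⟩ := hyps_eight_real
  have hu := isUnit_cast_of_coprime h8 ht
  have him0 := im_charSum_one_eq_zero ({1, 7} : Finset (ZMod 8)) 0 1 (by decide)
  have hv1 : (1 : ZMod 8).val = 1 := rfl
  have hv7 : (7 : ZMod 8).val = 7 := rfl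
  have helt : ζ ^ (n / 8) + ζ ^ (n / 8 * 7) =
      ((0 : ℕ) : K) + (1 : ℕ) * ∑ a ∈ ({1, 7} : Finset (ZMod 8)), ζ ^ (n / 8 * a.val) := by
    rw [Finset.sum_pair (by decide), hv1, hv7]; simp
  rw [helt, embedding_charSum_eq h8 hφ]
  exact ⟨re_charSum_neg_iff _ _ 0 1 H1 H2 H3 hu, im_charSum_eq_zero _ _ 0 1 H1 H2 him0 hu⟩

/-! ### §3 `√3`: `δ = ζ^{n/12} + ζ^{11n/12}`, `f = 12`, `S = {1,11}`, `S′ = {5,7}` -/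

/-- (H1)–(H3) at `f = 12`: units carry `{1,11}` to itself or to `{5,7}`; `Σ_{units} 𝐞₁₂ = 0`;
`Re(𝐞₁₂(1) + 𝐞₁₂(11)) = 2cos(π/6) > 0`.
research route conditional on HC_CM; not a corollary; Q11.4-sentence-2 already refuted in dim ≥ 3. [folklore] -/
theorem hyps_twelve :
    (∀ s : ZMod 12, IsUnit s → ({1, 11} : Finset (ZMod 12)).image (· * s) = {1, 11} ∨
        ({1, 11} : Finset (ZMod 12)).image (· * s) = {5, 7}) ∧
      (((1 : ℕ) : ℂ) * (∑ a ∈ ({1, 11} : Finset (ZMod 12)), 𝐞 a + ∑ a ∈ ({5, 7} : Finset (ZMod 12)), 𝐞 a) +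
          2 * ((0 : ℕ) : ℂ) = 0) ∧
      0 < ((((0 : ℕ) : ℂ)) + ((1 : ℕ) : ℂ) * ∑ a ∈ ({1, 11} : Finset (ZMod 12)), 𝐞 a).re := by
  refine ⟨fun s hs => ?_, ?_, ?_⟩
  · obtain ⟨u, rfl⟩ := hs
    have := ZMod.val_coe_unit_coprime u
    revert this; generalize (u : ZMod 12) = s; revert s; decide
  · rw [Finset.sum_pair (by decide), Finset.sum_pair (by decide),
      show (11 : ZMod 12) = ((11 : ℕ) : ZMod 12) by norm_num, show (5 : ZMod 12) = ((5 : ℕ) : ZMod 12) by norm_num,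
      show (7 : ZMod 12) = ((7 : ℕ) : ZMod 12) by norm_num]
    simp only [toCircle_natCast_eq_pow, Nat.cast_one, one_mul, Nat.cast_zero, mul_zero, add_zero]
    have h6 : (𝐞 (1 : ZMod 12)) ^ 6 = -1 := by
      have := toCircle_one_pow_half (f := 12) (by decide)
      norm_num at this
      exact this
    linear_combination (𝐞 (1 : ZMod 12) * (1 + (𝐞 (1 : ZMod 12)) ^ 4)) * h6
  · rw [Finset.sum_pair (by decide), show (11 : ZMod 12) = ((11 : ℕ) : ZMod 12) by norm_num]
    simp only [toCircle_natCast_eq_pow, Nat.cast_one, one_mul, Nat.cast_zero, zero_add, Complex.add_re,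
      im_re_toCircle_one, im_re_toCircle_one_pow]
    have hπ := Real.pi_pos
    have e11 : Real.cos (2 * π * (11 : ℕ) / (12 : ℕ)) = Real.cos (2 * π * (1 : ℕ) / (12 : ℕ)) := by
      rw [show (2 * π * (11 : ℕ) / (12 : ℕ) : ℝ) = 2 * π - 2 * π * (1 : ℕ) / (12 : ℕ) by push_cast; ring,
        Real.cos_two_pi_sub]
    have h1 : 0 < Real.cos (2 * π * (1 : ℕ) / (12 : ℕ)) :=
      Real.cos_pos_of_mem_Ioo ⟨by push_cast; nlinarith, by push_cast; nlinarith⟩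
    rw [e11]; linarith

/-- **`√3`, any level `n` with `12 ∣ n`: `Re φ(ζ^{n/12} + ζ^{11n/12}) < 0 ↔ t mod 12 ∈ {5, 7}`** (as
`{1,11}·t = {5,7}`), non-zero, `Im = 0` (`σ_t(√3) = χ_{12}(t)√3`).
research route conditional on HC_CM; not a corollary; Q11.4-sentence-2 already refuted in dim ≥ 3. [folklore] -/
theorem re_embedding_sqrtThree_neg_iff (h12 : 12 ∣ n) {φ : K →+* ℂ} {t : ZMod n} (hφ : φ ζ = 𝐞 t)
    (ht : t.val.Coprime n) :
    (((φ (ζ ^ (n / 12) + ζ ^ (n / 12 * 11))).re < 0 ↔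
        ({1, 11} : Finset (ZMod 12)).image (· * ((t.val : ℕ) : ZMod 12)) = {5, 7}) ∧
      (φ (ζ ^ (n / 12) + ζ ^ (n / 12 * 11))).re ≠ 0) ∧ (φ (ζ ^ (n / 12) + ζ ^ (n / 12 * 11))).im = 0 := by
  obtain ⟨H1, H2, H3⟩ := hyps_twelve
  have hu := isUnit_cast_of_coprime h12 ht
  have him0 := im_charSum_one_eq_zero ({1, 11} : Finset (ZMod 12)) 0 1 (by decide)
  have hv1 : (1 : ZMod 12).val = 1 := rfl
  have hv11 : (11 : ZMod 12).val = 11 := rfl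
  have helt : ζ ^ (n / 12) + ζ ^ (n / 12 * 11) =
      ((0 : ℕ) : K) + (1 : ℕ) * ∑ a ∈ ({1, 11} : Finset (ZMod 12)), ζ ^ (n / 12 * a.val) := by
    rw [Finset.sum_pair (by decide), hv1, hv11]; simp
  rw [helt, embedding_charSum_eq h12 hφ]
  exact ⟨re_charSum_neg_iff _ _ 0 1 H1 H2 H3 hu, im_charSum_eq_zero _ _ 0 1 H1 H2 him0 hu⟩

/-! ### §4 `√5`: `δ = 1 + 2(η + η⁴)`, `η = ζ^{n/5}`, `f = 5`, `S = {1,4}`, `S′ = {2,3}` -/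

/-- (H1)–(H3) at `f = 5`: units carry `{1,4}` to itself or to `{2,3}`; `2Σ_{k=1}^4 𝐞₅(k) + 2 = 0`;
`Re(1 + 2(𝐞₅(1) + 𝐞₅(4))) = 1 + 4cos(2π/5) > 0`.
research route conditional on HC_CM; not a corollary; Q11.4-sentence-2 already refuted in dim ≥ 3. [folklore] -/
theorem hyps_five :
    (∀ s : ZMod 5, IsUnit s → ({1, 4} : Finset (ZMod 5)).image (· * s) = {1, 4} ∨
        ({1, 4} : Finset (ZMod 5)).image (· * s) = {2, 3}) ∧
      (((2 : ℕ) : ℂ) * (∑ a ∈ ({1, 4} : Finset (ZMod 5)), 𝐞 a + ∑ a ∈ ({2, 3} : Finset (ZMod 5)), 𝐞 a) +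
          2 * ((1 : ℕ) : ℂ) = 0) ∧
      0 < ((((1 : ℕ) : ℂ)) + ((2 : ℕ) : ℂ) * ∑ a ∈ ({1, 4} : Finset (ZMod 5)), 𝐞 a).re := by
  refine ⟨fun s hs => ?_, ?_, ?_⟩
  · obtain ⟨u, rfl⟩ := hs
    have := ZMod.val_coe_unit_coprime u
    revert this; generalize (u : ZMod 5) = s; revert s; decide
  · rw [Finset.sum_pair (by decide), Finset.sum_pair (by decide),
      show (4 : ZMod 5) = ((4 : ℕ) : ZMod 5) by norm_num, show (2 : ZMod 5) = ((2 : ℕ) : ZMod 5) by norm_num,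
      show (3 : ZMod 5) = ((3 : ℕ) : ZMod 5) by norm_num]
    simp only [toCircle_natCast_eq_pow]
    have hg := geom_sum_toCircle_one (f := 5) (by norm_num)
    simp only [Finset.sum_range_succ, Finset.sum_range_zero, zero_add, pow_zero, pow_one] at hg
    push_cast
    linear_combination 2 * hg
  · rw [Finset.sum_pair (by decide), show (4 : ZMod 5) = ((4 : ℕ) : ZMod 5) by norm_num]
    simp only [toCircle_natCast_eq_pow]
    simp only [Complex.add_re, Complex.mul_re, Complex.natCast_re, Complex.natCast_im, zero_mul, sub_zero,
      im_re_toCircle_one, im_re_toCircle_one_pow]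
    have hπ := Real.pi_pos
    have e4 : Real.cos (2 * π * (4 : ℕ) / (5 : ℕ)) = Real.cos (2 * π * (1 : ℕ) / (5 : ℕ)) := by
      rw [show (2 * π * (4 : ℕ) / (5 : ℕ) : ℝ) = 2 * π - 2 * π * (1 : ℕ) / (5 : ℕ) by push_cast; ring,
        Real.cos_two_pi_sub]
    have h1 : 0 < Real.cos (2 * π * (1 : ℕ) / (5 : ℕ)) :=
      Real.cos_pos_of_mem_Ioo ⟨by push_cast; nlinarith, by push_cast; nlinarith⟩
    rw [e4]; push_cast at h1 ⊢; nlinarith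

/-- **`√5`, any level `n` with `5 ∣ n`: `Re φ(1 + 2(η + η⁴)) < 0 ↔ t mod 5 ∈ {2, 3}`** (`η = ζ^{n/5}`; as
`{1,4}·t = {2,3}`), non-zero, `Im = 0` (`1 + 2(η + η⁴) = √5` up to the embedding; `σ_t(√5) = (t/5)√5`).
research route conditional on HC_CM; not a corollary; Q11.4-sentence-2 already refuted in dim ≥ 3. [cite: Washington1997, Lemma 4.8] -/
theorem re_embedding_sqrtFive_neg_iff (h5 : 5 ∣ n) {φ : K →+* ℂ} {t : ZMod n} (hφ : φ ζ = 𝐞 t)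
    (ht : t.val.Coprime n) :
    (((φ (1 + 2 * (ζ ^ (n / 5) + ζ ^ (n / 5 * 4)))).re < 0 ↔
        ({1, 4} : Finset (ZMod 5)).image (· * ((t.val : ℕ) : ZMod 5)) = {2, 3}) ∧
      (φ (1 + 2 * (ζ ^ (n / 5) + ζ ^ (n / 5 * 4)))).re ≠ 0) ∧
      (φ (1 + 2 * (ζ ^ (n / 5) + ζ ^ (n / 5 * 4)))).im = 0 := by
  obtain ⟨H1, H2, H3⟩ := hyps_five
  have hu := isUnit_cast_of_coprime h5 ht
  have him0 := im_charSum_one_eq_zero ({1, 4} : Finset (ZMod 5)) 1 2 (by decide)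
  have hv1 : (1 : ZMod 5).val = 1 := rfl
  have hv4 : (4 : ZMod 5).val = 4 := rfl
  have helt : (1 + 2 * (ζ ^ (n / 5) + ζ ^ (n / 5 * 4)) : K) =
      ((1 : ℕ) : K) + (2 : ℕ) * ∑ a ∈ ({1, 4} : Finset (ZMod 5)), ζ ^ (n / 5 * a.val) := by
    rw [Finset.sum_pair (by decide), hv1, hv4]; push_cast; ring
  rw [helt, embedding_charSum_eq h5 hφ]
  exact ⟨re_charSum_neg_iff _ _ 1 2 H1 H2 H3 hu, im_charSum_eq_zero _ _ 1 2 H1 H2 him0 hu⟩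

/-! ### §5 `√13`: `δ = 1 + 2Σ_{a∈QR₁₃} η^a`, `η = ζ^{n/13}`, `f = 13`, `S = {1,3,4,9,10,12}`, `S′ = {2,5,6,7,8,11}` -/

/-- (H1)–(H3) at `f = 13`: units carry the quadratic residues to themselves or to the non-residues;
`2Σ_{k=1}^{12} 𝐞₁₃(k) + 2 = 0`; `Re(1 + 2Σ_{QR} 𝐞₁₃(a)) = 1 + 4(cos(2π/13) + cos(6π/13) + cos(8π/13)) > 0`.
research route conditional on HC_CM; not a corollary; Q11.4-sentence-2 already refuted in dim ≥ 3. [folklore] -/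
theorem hyps_thirteen :
    (∀ s : ZMod 13, IsUnit s →
        ({1, 3, 4, 9, 10, 12} : Finset (ZMod 13)).image (· * s) = {1, 3, 4, 9, 10, 12} ∨
        ({1, 3, 4, 9, 10, 12} : Finset (ZMod 13)).image (· * s) = {2, 5, 6, 7, 8, 11}) ∧
      (((2 : ℕ) : ℂ) * (∑ a ∈ ({1, 3, 4, 9, 10, 12} : Finset (ZMod 13)), 𝐞 a +
          ∑ a ∈ ({2, 5, 6, 7, 8, 11} : Finset (ZMod 13)), 𝐞 a) + 2 * ((1 : ℕ) : ℂ) = 0) ∧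
      0 < ((((1 : ℕ) : ℂ)) + ((2 : ℕ) : ℂ) * ∑ a ∈ ({1, 3, 4, 9, 10, 12} : Finset (ZMod 13)), 𝐞 a).re := by
  refine ⟨fun s hs => ?_, ?_, ?_⟩
  · obtain ⟨u, rfl⟩ := hs
    have := ZMod.val_coe_unit_coprime u
    revert this; generalize (u : ZMod 13) = s; revert s; decide
  · rw [Finset.sum_insert (by decide), Finset.sum_insert (by decide), Finset.sum_insert (by decide),
      Finset.sum_insert (by decide), Finset.sum_pair (by decide), Finset.sum_insert (by decide),
      Finset.sum_insert (by decide), Finset.sum_insert (by decide), Finset.sum_insert (by decide),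
      Finset.sum_pair (by decide),
      show (2 : ZMod 13) = ((2 : ℕ) : ZMod 13) by norm_num, show (3 : ZMod 13) = ((3 : ℕ) : ZMod 13) by norm_num,
      show (4 : ZMod 13) = ((4 : ℕ) : ZMod 13) by norm_num, show (5 : ZMod 13) = ((5 : ℕ) : ZMod 13) by norm_num,
      show (6 : ZMod 13) = ((6 : ℕ) : ZMod 13) by norm_num, show (7 : ZMod 13) = ((7 : ℕ) : ZMod 13) by norm_num,
      show (8 : ZMod 13) = ((8 : ℕ) : ZMod 13) by norm_num, show (9 : ZMod 13) = ((9 : ℕ) : ZMod 13) by norm_num,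
      show (10 : ZMod 13) = ((10 : ℕ) : ZMod 13) by norm_num, show (11 : ZMod 13) = ((11 : ℕ) : ZMod 13) by
        norm_num, show (12 : ZMod 13) = ((12 : ℕ) : ZMod 13) by norm_num]
    simp only [toCircle_natCast_eq_pow]
    have hg := geom_sum_toCircle_one (f := 13) (by norm_num)
    simp only [Finset.sum_range_succ, Finset.sum_range_zero, zero_add, pow_zero, pow_one] at hg
    push_cast
    linear_combination 2 * hg
  · rw [Finset.sum_insert (by decide), Finset.sum_insert (by decide), Finset.sum_insert (by decide),
      Finset.sum_insert (by decide), Finset.sum_pair (by decide),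
      show (3 : ZMod 13) = ((3 : ℕ) : ZMod 13) by norm_num, show (4 : ZMod 13) = ((4 : ℕ) : ZMod 13) by norm_num,
      show (9 : ZMod 13) = ((9 : ℕ) : ZMod 13) by norm_num, show (10 : ZMod 13) = ((10 : ℕ) : ZMod 13) by norm_num,
      show (12 : ZMod 13) = ((12 : ℕ) : ZMod 13) by norm_num]
    simp only [toCircle_natCast_eq_pow]
    simp only [Complex.add_re, Complex.mul_re, Complex.natCast_re, Complex.natCast_im, zero_mul, sub_zero,
      im_re_toCircle_one, im_re_toCircle_one_pow]
    have hπ := Real.pi_pos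
    have e12 : Real.cos (2 * π * (12 : ℕ) / (13 : ℕ)) = Real.cos (2 * π * (1 : ℕ) / (13 : ℕ)) := by
      rw [show (2 * π * (12 : ℕ) / (13 : ℕ) : ℝ) = 2 * π - 2 * π * (1 : ℕ) / (13 : ℕ) by push_cast; ring,
        Real.cos_two_pi_sub]
    have e10 : Real.cos (2 * π * (10 : ℕ) / (13 : ℕ)) = Real.cos (2 * π * (3 : ℕ) / (13 : ℕ)) := by
      rw [show (2 * π * (10 : ℕ) / (13 : ℕ) : ℝ) = 2 * π - 2 * π * (3 : ℕ) / (13 : ℕ) by push_cast; ring,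
        Real.cos_two_pi_sub]
    have e9 : Real.cos (2 * π * (9 : ℕ) / (13 : ℕ)) = Real.cos (2 * π * (4 : ℕ) / (13 : ℕ)) := by
      rw [show (2 * π * (9 : ℕ) / (13 : ℕ) : ℝ) = 2 * π - 2 * π * (4 : ℕ) / (13 : ℕ) by push_cast; ring,
        Real.cos_two_pi_sub]
    have e4 : Real.cos (2 * π * (4 : ℕ) / (13 : ℕ)) = -Real.cos (5 * π / 13) := by
      rw [show (2 * π * (4 : ℕ) / (13 : ℕ) : ℝ) = π - 5 * π / 13 by push_cast; ring, Real.cos_pi_sub]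
    have h15 : Real.cos (5 * π / 13) < Real.cos (2 * π * (1 : ℕ) / (13 : ℕ)) := by
      apply Real.cos_lt_cos_of_nonneg_of_le_pi <;> push_cast <;> nlinarith
    have h3 : 0 < Real.cos (2 * π * (3 : ℕ) / (13 : ℕ)) :=
      Real.cos_pos_of_mem_Ioo ⟨by push_cast; nlinarith, by push_cast; nlinarith⟩
    rw [e12, e10, e9, e4]
    push_cast at h15 h3 ⊢
    nlinarith

/-- **`√13`, any level `n` with `13 ∣ n`: `Re φ(1 + 2Σ_{a∈QR₁₃} η^a) < 0 ↔ t mod 13` is a non-residue**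
(`η = ζ^{n/13}`; as `QR·t = QNR`), non-zero, `Im = 0` (`σ_t(√13) = (t/13)√13`; used for `K = ℚ(√−13) ⊂ ℚ(ζ₅₂)`).
research route conditional on HC_CM; not a corollary; Q11.4-sentence-2 already refuted in dim ≥ 3. [cite: Washington1997, Lemma 4.8] -/
theorem re_embedding_sqrtThirteen_neg_iff (h13 : 13 ∣ n) {φ : K →+* ℂ} {t : ZMod n} (hφ : φ ζ = 𝐞 t)
    (ht : t.val.Coprime n) :
    (((φ (1 + 2 * (ζ ^ (n / 13) + ζ ^ (n / 13 * 3) + ζ ^ (n / 13 * 4) + ζ ^ (n / 13 * 9) + ζ ^ (n / 13 * 10) +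
          ζ ^ (n / 13 * 12)))).re < 0 ↔
        ({1, 3, 4, 9, 10, 12} : Finset (ZMod 13)).image (· * ((t.val : ℕ) : ZMod 13)) = {2, 5, 6, 7, 8, 11}) ∧
      (φ (1 + 2 * (ζ ^ (n / 13) + ζ ^ (n / 13 * 3) + ζ ^ (n / 13 * 4) + ζ ^ (n / 13 * 9) + ζ ^ (n / 13 * 10) +
          ζ ^ (n / 13 * 12)))).re ≠ 0) ∧
      (φ (1 + 2 * (ζ ^ (n / 13) + ζ ^ (n / 13 * 3) + ζ ^ (n / 13 * 4) + ζ ^ (n / 13 * 9) + ζ ^ (n / 13 * 10) +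
          ζ ^ (n / 13 * 12)))).im = 0 := by
  obtain ⟨H1, H2, H3⟩ := hyps_thirteen
  have hu := isUnit_cast_of_coprime h13 ht
  have him0 := im_charSum_one_eq_zero ({1, 3, 4, 9, 10, 12} : Finset (ZMod 13)) 1 2 (by decide)
  have hv1 : (1 : ZMod 13).val = 1 := rfl
  have hv3 : (3 : ZMod 13).val = 3 := rfl
  have hv4 : (4 : ZMod 13).val = 4 := rfl
  have hv9 : (9 : ZMod 13).val = 9 := rfl
  have hv10 : (10 : ZMod 13).val = 10 := rfl
  have hv12 : (12 : ZMod 13).val = 12 := rfl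
  have helt : (1 + 2 * (ζ ^ (n / 13) + ζ ^ (n / 13 * 3) + ζ ^ (n / 13 * 4) + ζ ^ (n / 13 * 9) + ζ ^ (n / 13 * 10) +
      ζ ^ (n / 13 * 12)) : K) =
      ((1 : ℕ) : K) + (2 : ℕ) * ∑ a ∈ ({1, 3, 4, 9, 10, 12} : Finset (ZMod 13)), ζ ^ (n / 13 * a.val) := by
    rw [Finset.sum_insert (by decide), Finset.sum_insert (by decide), Finset.sum_insert (by decide),
      Finset.sum_insert (by decide), Finset.sum_pair (by decide), hv1, hv3, hv4, hv9, hv10, hv12]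
    push_cast; ring
  rw [helt, embedding_charSum_eq h13 hφ]
  exact ⟨re_charSum_neg_iff _ _ 1 2 H1 H2 H3 hu, im_charSum_eq_zero _ _ 1 2 H1 H2 him0 hu⟩

end Summit.HodgeConjecture.Ring2WeilCoverage.ResidueDictionaryPiecesB

end
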